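import Literature.Geometry.Kaehler.ComplexTorusAlbertClassificationLowDimension
import Literature.Geometry.Kaehler.ComplexTorusCentralizerSkewForms
import Literature.NumberTheory.Automorphic.QuaternionInvolutionToolkit
import Mathlib.LinearAlgebra.Dual.Lemmas
import HarnessLib

/-!
# Shimura's exceptional case (1) in every dimension: a simple polarised complex torus of Albert type III
# has `m = g/2e ≥ 2` (Hulek–Laface 2019, Prop. 5.1, case (1); Shimura 1963, §4)

Layer `Literature/Geometry/Kaehler`, namespace `Literature.Geometry.Kaehler.ComplexTorus`; lane `lit-hodgefound`
(Track 2 foundations library), SKELETON row A2-32 «Albert classification of `End_ℚ` of a simple AV (types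
I–IV)»; seat p12 gen 10, row g10-#4.  THEOREMS ONLY (no definition, no named fact; D-0026, net debt 0).  Sequel of
`ComplexTorusAbelianSurfaceShimura.lean` (p18 g9-#1: the case `g = 2`,
`IsSimple.not_isAlbertTypeIII_of_finrank_eq_two`, whose header records «`-- TODO(general form)`: Shimura's
case (1) in every dimension `g = 2e` […] needs `F ⊗ ℝ`») — this file proves the general form, WITHOUT `F ⊗ ℝ`,
by rational descent — and of `ComplexTorusAlbertClassificationLowDimension.lean` (p12 g10-#2),
`ComplexTorusCentralizerSkewForms.lean` / `ComplexTorusHodgeGroupCommutative.lean` (Milne's `C(X)` over `ℚ`,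
`J ∈ C(X) ⊗ ℝ`).

## The print

K. Hulek, R. Laface, *On the Picard numbers of abelian varieties*, Ann. Sc. Norm. Super. Pisa (2019), §5.1
(held text `paper:arxiv-1703.05882`, p0010), **Proposition 5.1**, VERBATIM: «Let `g` be a fixed positive
integer. For all positive integers `ρ` that satisfy one of the conditions above, there exists a simple abelian
variety `X` of the corresponding type such that `ρ(X) = ρ`, unless we are in one of the five following
exceptional cases: • `F` is of type III, and `m := g/2e = 1`; • […]. *Proof.* It is a theorem of Shimura that
given an endomorphism structure `(F, ′, ι)` one has that a general member `(X, H, ι)` of the moduli space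
`𝒜(ℳ, T)` has the property `End_ℚ(X) = ι(F)`, except in the cases above (for example see [shimura63], or
[birkenhake-lange04] for a modern approach).  In fact, under the assumption that our abelian variety `X` be
simple, one can show that these cases never occur: • `X` is isogenous to a square `Y²`, where `Y` is an abelian
variety of dimension `e₀`, contradicting the fact that `X` is simple; […]».  Here (HL §2, Lange §2.6.1 table,
p0138) for type III `F = End_ℚ(X)` is a totally definite quaternion algebra over a totally real field `K`,
`e = [K : ℚ]`, `[F : ℚ] = 4e`, and `2g = [F : ℚ] · m`, i.e. `g = 2em`; the table's restriction is `2e ∣ g`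
(`m ∈ ℕ`), and case (1) says `m ≠ 1` for simple `X`.  The original is G. Shimura, *On analytic families of
polarized abelian varieties and automorphic functions*, Ann. of Math. 78 (1963) 149–192, §4 (paywalled here;
cited through Hulek–Laface).  Consumers in print: B. Moonen, Yu. Zarhin, *Hodge classes on abelian varieties of
low dimension* (1999), §2 (held `paper:arxiv-math_9901113`), p0005 «type 3 does not occur for `g ≤ 3` and
`g = 5` (`X` simple!)», p0006 «a simple `X` of prime dimension cannot be of Type 3».

## What is proved (simple polarised complex torus `X = E/Ψ(ℤ^κ)`, `F = End_ℚ(X) = endAlgRat Ψ ⊆ M_κ(ℚ)`,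
centre `K = centerField Ψ hX`, `e = [K : ℚ]`, Rosati involution `′ = rosatiEnd` of a polarisation `η` with
rational Gram matrix `G`, `g = dim_ℂ E`, `|κ| = 2g`)

* **`IsSimple.finrank_endAlgRat_ne_card_of_isAlbertTypeIII`**,
  **`IsSimple.finrank_endAlgRat_ne_two_mul_finrank_of_isAlbertTypeIII`** — type III ⟹ `dim_ℚ F ≠ 2g`
  (case (1): `m ≠ 1`);
* **`IsSimple.exists_finrank_eq_two_mul_mul_of_isAlbertTypeIII`** — type III ⟹ `g = 2em` with `m ≥ 2`;
  `IsSimple.four_mul_finrank_centerField_le_of_isAlbertTypeIII` — `4e ≤ g`;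
* **`IsSimple.not_isAlbertTypeIII_of_prime`** (Moonen–Zarhin: no type III in prime dimension),
  **`IsSimple.finrank_centerField_eq_one_of_isAlbertTypeIII_of_finrank_le_seven`** (`g ≤ 7` and type III ⟹
  `K = ℚ` and `g ∈ {4, 6}`; in particular none for `g ≤ 3`, `g = 5`, `g = 7`).
* §5, polarisation-free forms when `End_ℚ(X)` is a totally definite quaternion algebra over its centre (type III
  is then automatic, `IsSimple.isAlbertTypeIII_of_isTotallyDefinite`):
  **`IsSimple.finrank_endAlgRat_ne_two_mul_finrank_of_isTotallyDefinite`**,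
  `IsSimple.exists_finrank_eq_two_mul_mul_of_isTotallyDefinite`, `IsSimple.four_mul_finrank_centerField_le_of_isTotallyDefinite`,
  `IsSimple.not_isTotallyDefinite_of_prime` (generalising the tree's `IsSimple.not_isTotallyDefinite_of_finrank_eq_two`).
* §6: the `g = 4` case list with case (1) built in, `IsSimple.endAlgRat_cases_of_finrank_eq_four'` (type III at
  `g = 4` only over `K = ℚ`), `IsSimple.finrank_centerField_eq_one_of_isTotallyDefinite_of_finrank_eq_four`.
* The two engines, stated for reuse: **`exists_skew_mem_centralizer_forall_commute`** (rational core, below) and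
  **`mem_endAlgRat_of_forall_skew_centralizer_commute`** (a rational matrix commuting with the `†`-skew part of
  Milne's `C(X)` is an endomorphism), and `IsSimple.add_rosati_mul_comm_of_isAlbertTypeIII` (type III ⟹
  `f + f'` central, i.e. `′ = x̄`, Thm. 2.6.5 (c)).

## Proof route (declared deviation: an elementary RATIONAL argument — neither Shimura's moduli count nor
Hulek–Laface's isogeny `X ∼ Y²`; no real structure `F ⊗ ℝ ≅ ℍ^e` is used)

Suppose `dim_ℚ F = |κ| = rk Λ`.  §1 (pure linear algebra over `ℚ`, `exists_skew_mem_centralizer_forall_commute`):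
`F` is a skew field (`IsSimple.isUnit_of_mem_endAlgRat`), so the orbit map `θ : F → Λ_ℚ = ℚ^κ`, `A ↦ Av`, of a
non-zero vector is a linear isomorphism (`exists_linearEquiv_mulVec`); through `θ` the rational commutant
`C = C(X)` of `F` is the algebra of right multiplications `R_ζ`, `ζ ∈ F`.  The polarisation `(x, y) ↦ ᵗx G y`
reads `(θA, θB) ↦ ᵗv G (A†B v) = Tr(ξ A†B)` for a unique `ξ ∈ F` (Riesz for the trace pairing, non-degenerate by
the positivity `Tr(A†A) > 0`, Thm. 2.4.9 = `trace_rosati_mul_self_pos_rat`), with `ξ† = -ξ` (the form is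
alternating) and `ξ ≠ 0`.  For type III `†|_F = ′` is the canonical involution (`A + A†` central,
`IsSimple.add_rosati_mul_comm_of_isAlbertTypeIII`), so `q = ξ²` is central and invertible.  A `†`-skew `R_ζ ∈ C`
satisfies `Tr(ξ ζ† B) = -Tr(ζ ξ B)` for all `B ∈ F`, i.e. `ξ ζ† = -ζ ξ`; writing `ζ† = t - ζ` with `t` central
gives `[ζ, ξ] = -tξ`, and `ξ[ζ, ξ] + [ζ, ξ]ξ = [ζ, q] = 0 = -2tq`, so `t = 0` and `[ζ, ξ] = 0`: every skew
element of `C` commutes with the non-zero skew element `a = R_ξ`.  §2 (`mem_endAlgRat_of_forall_skew_centralizer_commute`):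
`J ∈ C ⊗ ℝ` (`jMatrix_mem_span_centralizer_endAlgRat`) and `J† = -J` (`rosati_jMatrix`), so `2J` is a real
combination of the rational skew elements `γ - γ†`, `γ ∈ C` (`C` is `†`-stable,
`IsRiemannForm.rosati_mem_centralizer_endAlgRat`), hence commutes with `a`; thus `a ∈ End_ℚ(X) = {A | AJ = JA}`.
§3: `a ∈ End_ℚ(X) ∩ C = K` and `′` is of the first kind, so `a† = a`, contradicting `a† = -a ≠ 0`.  (For type II,
`′ = c x̄ c⁻¹`, the same computation allows `ξ` central and nothing follows — consistent with QM surfaces.)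
§4: `[F : ℚ] = 4e ∣ 2g` (`IsSimple.finrank_centerField_mul_finrank_dvd`) and `≠ 2g` give `g = 2em`, `m ≥ 2`.

## References

* [HulekLaface2019PicardNumbersAV] K. Hulek, R. Laface, *On the Picard numbers of abelian varieties*, Ann. Sc.
  Norm. Super. Pisa Cl. Sci. (5) XIX (2019), §5.1 Prop. 5.1 and proof, exceptional case (1).
* [Shimura1963AnalyticFamilies] G. Shimura, *On analytic families of polarized abelian varieties and automorphic
  functions*, Ann. of Math. (2) 78 (1963), 149–192, §4.
* [MoonenZarhin1999LowDim] B. Moonen, Yu. Zarhin, *Hodge classes on abelian varieties of low dimension*, Math.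
  Ann. 315 (1999), §2.
* [Lange2023AbelianVarietiesComplex] H. Lange, *Abelian Varieties over the Complex Numbers* (2023), §2.4.1
  Thm. 2.4.9, §2.6.1 Proposition (table, p. 138), §2.6.2 Thm. 2.6.5 (c), §7.2.2–7.2.3 Props. 7.2.5, 7.2.6.
* [Milne1999LefschetzClasses] J. S. Milne, *Lefschetz classes on abelian varieties*, Duke Math. J. 96 (1999), §1.
* [VignerasLNM800] M.-F. Vignéras, *Arithmétique des algèbres de quaternions*, LNM 800 (1980), Ch. V §1 Ex. 1.1 (a).
-/

noncomputable section

open Module Matrix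

namespace Literature.Geometry.Kaehler

namespace ComplexTorus

/-! ## §1 The rational core: a rank-one module over a skew field with a symplectic anti-involution of
"standard" type on `F` forces a commutative skew part on the commutant -/

section RationalCore

variable {ι : Type*} [Fintype ι] [DecidableEq ι]

/-- `Λ_ℚ ≅ F` for a skew field `F ⊆ M_ι(ℚ)` with `dim_ℚ F = |ι|`: the orbit map `A ↦ A v` of a non-zero
vector is a linear isomorphism (injective since non-zero elements of `F` are invertible matrices, and the
dimensions agree). [folklore] -/
private theorem exists_linearEquiv_mulVec (F : Subalgebra ℚ (Matrix ι ι ℚ))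
    (hdiv : ∀ A ∈ F, A ≠ 0 → IsUnit A) (hdim : finrank ℚ F = Fintype.card ι) {v : ι → ℚ}
    (hv : v ≠ 0) : ∃ θ : F ≃ₗ[ℚ] (ι → ℚ), ∀ A : F, θ A = (A : Matrix ι ι ℚ) *ᵥ v := by
  let f : F →ₗ[ℚ] (ι → ℚ) :=
    { toFun := fun A ↦ (A : Matrix ι ι ℚ) *ᵥ v
      map_add' := fun A B ↦ by simp only [Subalgebra.coe_add, Matrix.add_mulVec]
      map_smul' := fun c A ↦ by simp only [Subalgebra.coe_smul, Matrix.smul_mulVec, RingHom.id_apply] }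
  have hf : Function.Injective f := by
    intro A B hAB
    by_contra hne
    have hne' : (A : Matrix ι ι ℚ) - (B : Matrix ι ι ℚ) ≠ 0 :=
      fun h ↦ hne (Subtype.ext (sub_eq_zero.1 h))
    have hu : IsUnit ((A : Matrix ι ι ℚ) - (B : Matrix ι ι ℚ)) := hdiv _ (F.sub_mem A.2 B.2) hne'
    have hinj := Matrix.mulVec_injective_iff_isUnit.2 hu
    have h0 : ((A : Matrix ι ι ℚ) - (B : Matrix ι ι ℚ)) *ᵥ v =
        ((A : Matrix ι ι ℚ) - (B : Matrix ι ι ℚ)) *ᵥ 0 := by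
      rw [Matrix.mulVec_zero, Matrix.sub_mulVec]
      exact sub_eq_zero.2 hAB
    exact hv (hinj h0)
  have hdim' : finrank ℚ F = finrank ℚ (ι → ℚ) := by rw [hdim, Module.finrank_fintype_fun_eq_card]
  exact ⟨f.linearEquivOfInjective hf hdim', fun A ↦ rfl⟩

/-- Non-degeneracy of the trace pairing `(Y, B) ↦ Tr(Y B)` on `F`, from the positivity `Tr(A†A) > 0` of a
`†`-stable `F`. [folklore] -/
private theorem eq_zero_of_forall_trace_mul_eq_zero (F : Subalgebra ℚ (Matrix ι ι ℚ)) {G : Matrix ι ι ℚ}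
    (hFr : ∀ A ∈ F, rosati G A ∈ F) (hpos : ∀ A ∈ F, A ≠ 0 → 0 < (rosati G A * A).trace)
    {Y : Matrix ι ι ℚ} (hY : Y ∈ F) (h : ∀ B ∈ F, (Y * B).trace = 0) : Y = 0 := by
  by_contra hY0
  have h1 := hpos Y hY hY0
  rw [Matrix.trace_mul_comm, h _ (hFr Y hY)] at h1
  exact lt_irrefl _ h1

/-- Riesz representation for the trace pairing on `F`: every linear functional on `F` is `B ↦ Tr(ξ B)` for a
unique `ξ ∈ F` (injectivity by non-degeneracy, surjectivity by `dim F* = dim F`). [folklore] -/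
private theorem exists_eq_trace_mul (F : Subalgebra ℚ (Matrix ι ι ℚ)) {G : Matrix ι ι ℚ}
    (hFr : ∀ A ∈ F, rosati G A ∈ F) (hpos : ∀ A ∈ F, A ≠ 0 → 0 < (rosati G A * A).trace)
    (φ : Module.Dual ℚ F) : ∃ ξ : F, ∀ B : F, φ B = ((ξ : Matrix ι ι ℚ) * B).trace := by
  let Ψ : F →ₗ[ℚ] Module.Dual ℚ F := LinearMap.mk₂ ℚ
    (fun Y B ↦ ((Y : Matrix ι ι ℚ) * B).trace)
    (fun Y Y' B ↦ by simp only [Subalgebra.coe_add, Matrix.add_mul, Matrix.trace_add])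
    (fun c Y B ↦ by simp only [Subalgebra.coe_smul, Matrix.smul_mul, Matrix.trace_smul, smul_eq_mul])
    (fun Y B B' ↦ by simp only [Subalgebra.coe_add, Matrix.mul_add, Matrix.trace_add])
    (fun c Y B ↦ by simp only [Subalgebra.coe_smul, Matrix.mul_smul, Matrix.trace_smul, smul_eq_mul])
  have hΨ : Function.Injective Ψ := by
    intro Y Y' hYY'
    have h0 : ∀ B ∈ F, (((Y : Matrix ι ι ℚ) - Y') * B).trace = 0 := by
      intro B hB
      have := congrArg (fun ψ : Module.Dual ℚ F ↦ ψ ⟨B, hB⟩) hYY'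
      simp only [Ψ, LinearMap.mk₂_apply] at this
      rw [Matrix.sub_mul, Matrix.trace_sub, this, sub_self]
    exact Subtype.ext (sub_eq_zero.1
      (eq_zero_of_forall_trace_mul_eq_zero F hFr hpos (F.sub_mem Y.2 Y'.2) h0))
  have hsurj : Function.Surjective Ψ :=
    (LinearMap.injective_iff_surjective_of_finrank_eq_finrank (Subspace.dual_finrank_eq).symm).1 hΨ
  obtain ⟨ξ, hξ⟩ := hsurj φ
  exact ⟨ξ, fun B ↦ by rw [← hξ]; rfl⟩

/-- Two matrices agreeing on the image of a surjection onto `ℚ^ι` are equal. [folklore] -/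
private theorem eq_of_forall_mulVec_apply_eq {F : Type*} (θ : F → (ι → ℚ)) (hθ : Function.Surjective θ)
    {M N : Matrix ι ι ℚ} (h : ∀ A, M *ᵥ θ A = N *ᵥ θ A) : M = N :=
  Matrix.ext_of_mulVec_single fun i ↦ by
    obtain ⟨A, hA⟩ := hθ (Pi.single i 1)
    rw [← hA, h]

omit [DecidableEq ι] in
/-- The alternating form `(x, y) ↦ ᵗx G y` is skew. [folklore] -/
private theorem dotProduct_mulVec_skew {G : Matrix ι ι ℚ} (hGt : Gᵀ = -G) (x y : ι → ℚ) :
    y ⬝ᵥ G *ᵥ x = -(x ⬝ᵥ G *ᵥ y) := by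
  rw [Matrix.dotProduct_mulVec, dotProduct_comm, ← Matrix.mulVec_transpose, hGt, Matrix.neg_mulVec,
    dotProduct_neg]

/-- Substitution helper for non-commutative rearrangements: `X = Y` from `X - Y = U - V` and `U = V`.
[folklore] -/
private theorem eq_of_sub_eq_sub {R : Type*} [Ring R] {X Y U V : R} (h : X - Y = U - V) (hUV : U = V) :
    X = Y := by
  rw [hUV, sub_self] at h
  exact sub_eq_zero.1 h

/-- **The rational core of Shimura's exceptional case (1).** Let `F ⊆ M_ι(ℚ)` be a `ℚ`-subalgebra which is
a skew field of dimension `|ι|` (so `ℚ^ι` is a rank-one `F`-module), `G` an invertible alternating matrix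
whose adjoint anti-involution `† = rosati G` preserves `F`, is positive on `F` (`Tr(A†A) > 0`) and is
"of standard type" on `F` (`A + A†` is central in `F` for every `A ∈ F`, as for `x ↦ x̄` on a quaternion
algebra).  Then the commutant `C` of `F` contains a non-zero `†`-skew element `a` commuting with EVERY
`†`-skew element of `C`.  (In the model `ℚ^ι = F·v`: `C` is the algebra of right multiplications, the form
is `(Av, Bv) ↦ Tr(ξ A†B)` with `ξ† = -ξ ≠ 0`, `a = R_ξ`, and a skew `R_ζ` satisfies `ξ ζ† = -ζ ξ`, which
with `ζ† = t - ζ`, `t` central, forces `t = 0` and `[ζ, ξ] = 0`.)  This is the algebraic core of the proof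
given here of Hulek–Laface Prop. 5.1, case (1) (positivity input: Lange Thm. 2.4.9).
[cite: HulekLaface2019PicardNumbersAV, §5.1 Prop. 5.1, exceptional case (1) (arXiv p. 10)]
[cite: Lange2023AbelianVarietiesComplex, §2.4.1 Thm. 2.4.9 (positivity of the Rosati trace form)] -/
theorem exists_skew_mem_centralizer_forall_commute [Nonempty ι] (F : Subalgebra ℚ (Matrix ι ι ℚ))
    {G : Matrix ι ι ℚ} (hGu : IsUnit G.det) (hGt : Gᵀ = -G) (hFr : ∀ A ∈ F, rosati G A ∈ F)
    (hdiv : ∀ A ∈ F, A ≠ 0 → IsUnit A) (hpos : ∀ A ∈ F, A ≠ 0 → 0 < (rosati G A * A).trace)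
    (hcen : ∀ A ∈ F, ∀ B ∈ F, (A + rosati G A) * B = B * (A + rosati G A))
    (hdim : finrank ℚ F = Fintype.card ι) :
    ∃ a ∈ Subalgebra.centralizer ℚ (F : Set (Matrix ι ι ℚ)), a ≠ 0 ∧ rosati G a = -a ∧
      ∀ c ∈ Subalgebra.centralizer ℚ (F : Set (Matrix ι ι ℚ)), rosati G c = -c → c * a = a * c := by
  classical
  -- §a. The rank-one model `θ : F ≃ ℚ^ι`, `A ↦ A v`.
  obtain ⟨i₀⟩ := ‹Nonempty ι›
  set v : ι → ℚ := Pi.single i₀ (1 : ℚ) with hv_def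
  have hv : v ≠ 0 := by
    intro h
    have h1 := congrFun h i₀
    rw [hv_def, Pi.single_eq_same, Pi.zero_apply] at h1
    exact one_ne_zero h1
  obtain ⟨θ, hθ⟩ := exists_linearEquiv_mulVec F hdiv hdim hv
  have hθmul : ∀ (B : Matrix ι ι ℚ) (hB : B ∈ F) (A : F), B *ᵥ θ A = θ (⟨B, hB⟩ * A) := by
    intro B hB A
    rw [hθ, hθ, Matrix.mulVec_mulVec]
    rfl
  have hθmul' : ∀ B A : F, (B : Matrix ι ι ℚ) *ᵥ θ A = θ (B * A) := fun B A ↦ hθmul B B.2 A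
  have hext : ∀ {M N : Matrix ι ι ℚ}, (∀ A : F, M *ᵥ θ A = N *ᵥ θ A) → M = N :=
    fun h ↦ eq_of_forall_mulVec_apply_eq θ θ.surjective h
  -- §b. The functional `φ(B) = ᵗv G (B v)` and its Riesz representative `ξ`: `φ(B) = Tr(ξ B)`.
  let φ : Module.Dual ℚ F :=
    { toFun := fun B ↦ v ⬝ᵥ G *ᵥ θ B
      map_add' := fun A B ↦ by simp only [map_add, Matrix.mulVec_add, dotProduct_add]
      map_smul' := fun c A ↦ by
        simp only [map_smul, Matrix.mulVec_smul, dotProduct_smul, smul_eq_mul, RingHom.id_apply] }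
  obtain ⟨ξ, hξ⟩ := exists_eq_trace_mul F hFr hpos φ
  -- the form in the model: `ᵗ(θA) G (θB) = Tr(ξ A† B)`
  have hform : ∀ A B : F,
      θ A ⬝ᵥ G *ᵥ θ B = ((ξ : Matrix ι ι ℚ) * (rosati G A * B)).trace := by
    intro A B
    have h1 : θ A ⬝ᵥ G *ᵥ θ B = φ (⟨rosati G A, hFr _ A.2⟩ * B) := by
      change _ = v ⬝ᵥ G *ᵥ θ (⟨rosati G A, hFr _ A.2⟩ * B)
      rw [← hθmul (rosati G (A : Matrix ι ι ℚ)) (hFr _ A.2) B, hθ A]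
      exact dotProduct_mulVec_rosati hGu _ _ _
    rw [h1, hξ]
    rfl
  -- §c. `ξ† = -ξ`.
  have hξskew : rosati G (ξ : Matrix ι ι ℚ) = -(ξ : Matrix ι ι ℚ) := by
    have key : ∀ B : F, ((ξ : Matrix ι ι ℚ) * rosati G B).trace = -((ξ : Matrix ι ι ℚ) * B).trace := by
      intro B
      have h1 := hform B 1
      have h2 := hform 1 B
      rw [Subalgebra.coe_one, Matrix.mul_one] at h1
      rw [Subalgebra.coe_one, rosati_one hGu, Matrix.one_mul] at h2
      rw [← h1, ← h2]
      exact dotProduct_mulVec_skew hGt _ _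
    have h0 : ∀ B ∈ F, (((ξ : Matrix ι ι ℚ) + rosati G ξ) * B).trace = 0 := by
      intro B hB
      have h3 : ((ξ : Matrix ι ι ℚ) * rosati G B).trace = (rosati G (ξ : Matrix ι ι ℚ) * B).trace := by
        rw [← trace_rosati hGu ((ξ : Matrix ι ι ℚ) * rosati G B), rosati_mul hGu, rosati_rosati hGu hGt,
          Matrix.trace_mul_comm]
      rw [Matrix.add_mul, Matrix.trace_add, ← h3, key ⟨B, hB⟩]
      exact add_neg_cancel _
    have := eq_zero_of_forall_trace_mul_eq_zero F hFr hpos (F.add_mem ξ.2 (hFr _ ξ.2)) h0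
    exact eq_neg_of_add_eq_zero_right this
  -- §d. `ξ ≠ 0` (the form is non-degenerate and `v ≠ 0`).
  have hξ0 : (ξ : Matrix ι ι ℚ) ≠ 0 := by
    intro h0
    have h1 : φ (θ.symm (G⁻¹ *ᵥ v)) = 0 := by rw [hξ, h0, Matrix.zero_mul, Matrix.trace_zero]
    have h2 : φ (θ.symm (G⁻¹ *ᵥ v)) = v ⬝ᵥ v := by
      change v ⬝ᵥ G *ᵥ θ (θ.symm (G⁻¹ *ᵥ v)) = _
      rw [LinearEquiv.apply_symm_apply, Matrix.mulVec_mulVec, Matrix.mul_nonsing_inv _ hGu,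
        Matrix.one_mulVec]
    exact hv (dotProduct_self_eq_zero.1 (h2.symm.trans h1))
  have hξu : IsUnit (ξ : Matrix ι ι ℚ) := hdiv _ ξ.2 hξ0
  -- §e. `q = ξ²` is central in `F` and invertible.
  have hqcen : ∀ B ∈ F, (ξ : Matrix ι ι ℚ) * ξ * B = B * ((ξ : Matrix ι ι ℚ) * ξ) := by
    intro B hB
    have h1 := hcen _ (F.mul_mem ξ.2 ξ.2) B hB
    rw [rosati_mul hGu, hξskew, neg_mul_neg, ← two_smul ℚ, Matrix.smul_mul, Matrix.mul_smul] at h1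
    exact smul_right_injective (Matrix ι ι ℚ) (two_ne_zero) h1
  have hqu : IsUnit ((ξ : Matrix ι ι ℚ) * ξ) := hξu.mul hξu
  -- §f. Right multiplications `R ζ` (transported through `θ`): `R ζ (θ A) = θ (A ζ)`; they exhaust `C`.
  let R : F → Matrix ι ι ℚ := fun ζ ↦
    LinearMap.toMatrix' (θ.toLinearMap ∘ₗ LinearMap.mulRight ℚ ζ ∘ₗ θ.symm.toLinearMap)
  have hR : ∀ ζ A : F, R ζ *ᵥ θ A = θ (A * ζ) := by
    intro ζ A
    simp only [R, LinearMap.toMatrix'_mulVec, LinearMap.coe_comp, LinearEquiv.coe_coe,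
      Function.comp_apply, LinearEquiv.symm_apply_apply, LinearMap.mulRight_apply]
  have hRmem : ∀ ζ : F, R ζ ∈ Subalgebra.centralizer ℚ (F : Set (Matrix ι ι ℚ)) := by
    intro ζ
    rw [Subalgebra.mem_centralizer_iff]
    intro B hB
    refine hext fun A ↦ ?_
    rw [← Matrix.mulVec_mulVec, hR, hθmul B hB, ← Matrix.mulVec_mulVec, hθmul B hB, hR, mul_assoc]
  have hRsurj : ∀ c ∈ Subalgebra.centralizer ℚ (F : Set (Matrix ι ι ℚ)), c = R (θ.symm (c *ᵥ v)) := by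
    intro c hc
    rw [Subalgebra.mem_centralizer_iff] at hc
    refine hext fun A ↦ ?_
    rw [hR, ← hθmul' A, LinearEquiv.apply_symm_apply, Matrix.mulVec_mulVec, hc _ A.2,
      ← Matrix.mulVec_mulVec, ← hθ]
  -- §g. A `†`-skew `R ζ` satisfies `ξ ζ† = -ζ ξ`.
  have hskewrel : ∀ ζ : F, rosati G (R ζ) = -R ζ →
      (ξ : Matrix ι ι ℚ) * rosati G ζ = -((ζ : Matrix ι ι ℚ) * ξ) := by
    intro ζ hζ
    have key : ∀ B : F, ((ξ : Matrix ι ι ℚ) * (rosati G ζ * B)).trace =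
        -((ξ : Matrix ι ι ℚ) * (B * ζ)).trace := by
      intro B
      have h1 : R ζ *ᵥ θ 1 ⬝ᵥ G *ᵥ θ B = θ 1 ⬝ᵥ G *ᵥ (rosati G (R ζ) *ᵥ θ B) :=
        dotProduct_mulVec_rosati hGu _ _ _
      rw [hζ, Matrix.neg_mulVec, Matrix.mulVec_neg, dotProduct_neg, hR, hR, one_mul, hform, hform,
        Subalgebra.coe_one, rosati_one hGu, Matrix.one_mul] at h1
      rw [h1]
      rfl
    have h0 : ∀ B ∈ F, (((ξ : Matrix ι ι ℚ) * rosati G ζ + ζ * ξ) * B).trace = 0 := by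
      intro B hB
      have h2 := key ⟨B, hB⟩
      simp only at h2
      rw [Matrix.add_mul, Matrix.trace_add, Matrix.mul_assoc, h2, Matrix.mul_assoc,
        Matrix.trace_mul_cycle' (ξ : Matrix ι ι ℚ) B ζ, ← Matrix.mul_assoc, neg_add_cancel]
    have hmem : (ξ : Matrix ι ι ℚ) * rosati G ζ + ζ * ξ ∈ F :=
      F.add_mem (F.mul_mem ξ.2 (hFr _ ζ.2)) (F.mul_mem ζ.2 ξ.2)
    exact eq_neg_of_add_eq_zero_left (eq_zero_of_forall_trace_mul_eq_zero F hFr hpos hmem h0)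
  -- §h. The algebra: `ξ ζ† = -ζ ξ`, `ζ† = t - ζ` with `t` central, `ξ² = q` central invertible ⟹ `[ζ, ξ] = 0`.
  have hcomm_of_skew : ∀ ζ : F, rosati G (R ζ) = -R ζ →
      (ζ : Matrix ι ι ℚ) * ξ = (ξ : Matrix ι ι ℚ) * ζ := by
    intro ζ hζ
    have h1 := hskewrel ζ hζ
    set ξm : Matrix ι ι ℚ := (ξ : Matrix ι ι ℚ) with hξm
    set ζm : Matrix ι ι ℚ := (ζ : Matrix ι ι ℚ) with hζm
    set t : Matrix ι ι ℚ := ζm + rosati G ζm with ht_def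
    have htξ : t * ξm = ξm * t := hcen _ ζ.2 _ ξ.2
    have hqζ : ξm * ξm * ζm = ζm * (ξm * ξm) := hqcen _ ζ.2
    -- `d := ζ ξ - ξ ζ = -(t ξ)`
    have hd : ζm * ξm - ξm * ζm = -(t * ξm) := by
      have h2 : rosati G ζm = t - ζm := by rw [ht_def, add_sub_cancel_left]
      rw [h2, Matrix.mul_sub] at h1
      -- h1 : ξ t - ξ ζ = -(ζ ξ)
      refine eq_of_sub_eq_sub ?_ h1
      rw [htξ]
      noncomm_ring
    -- `ξ d + d ξ = 0` (as `q ζ = ζ q`) and `ξ d + d ξ = -2 t q`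
    have hsum1 : ξm * (ζm * ξm - ξm * ζm) + (ζm * ξm - ξm * ζm) * ξm = 0 := by
      refine eq_of_sub_eq_sub ?_ hqζ.symm
      noncomm_ring
    have hsum2 : ξm * (ζm * ξm - ξm * ζm) + (ζm * ξm - ξm * ζm) * ξm =
        -((2 : ℚ) • (t * (ξm * ξm))) := by
      have e : ξm * -(t * ξm) + -(t * ξm) * ξm = -(ξm * t * ξm + t * (ξm * ξm)) := by noncomm_ring
      rw [hd, e, ← htξ, Matrix.mul_assoc, two_smul]
    have htq : t * (ξm * ξm) = 0 := by
      have h3 : (2 : ℚ) • (t * (ξm * ξm)) = 0 := by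
        rw [← neg_eq_zero, ← hsum2, hsum1]
      exact (smul_eq_zero.1 h3).resolve_left two_ne_zero
    have ht0 : t = 0 := (hqu.mul_left_eq_zero).1 htq
    rw [ht0, zero_mul, neg_zero, sub_eq_zero] at hd
    exact hd
  -- §i. Conclusion with `a = R ξ`.
  refine ⟨R ξ, hRmem ξ, ?_, ?_, ?_⟩
  · -- `a ≠ 0`: `a (θ 1) = θ ξ ≠ 0`
    intro h0
    have h1 : θ (1 * ξ) = 0 := by rw [← hR, h0, Matrix.zero_mulVec]
    rw [one_mul, LinearEquiv.map_eq_zero_iff] at h1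
    exact hξ0 (by rw [h1]; rfl)
  · -- `a† = -a`: `ᵗ(a x) G y = -ᵗx G (a y)` on `x = θA`, `y = θB`
    rw [rosati_eq_iff hGu, ← forall_dotProduct_mulVec_eq_iff_transpose_mul_eq]
    intro x y
    obtain ⟨A, rfl⟩ := θ.surjective x
    obtain ⟨B, rfl⟩ := θ.surjective y
    rw [Matrix.neg_mulVec, hR, hR, ← map_neg θ, hform, hform, Subalgebra.coe_mul, rosati_mul hGu,
      hξskew, Subalgebra.coe_neg, Subalgebra.coe_mul]
    have e1 : (ξ : Matrix ι ι ℚ) * (-(ξ : Matrix ι ι ℚ) * rosati G A * B) =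
        -((ξ : Matrix ι ι ℚ) * ξ * (rosati G A * B)) := by noncomm_ring
    have e2 : (ξ : Matrix ι ι ℚ) * (rosati G A * -((B : Matrix ι ι ℚ) * ξ)) =
        -((ξ : Matrix ι ι ℚ) * (rosati G A * B) * ξ) := by noncomm_ring
    rw [e1, e2, Matrix.trace_neg, Matrix.trace_neg,
      Matrix.trace_mul_comm ((ξ : Matrix ι ι ℚ) * (rosati G (A : Matrix ι ι ℚ) * (B : Matrix ι ι ℚ)))
        (ξ : Matrix ι ι ℚ)]
    simp only [Matrix.mul_assoc]
  · -- every skew `c ∈ C` commutes with `a`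
    intro c hc hcskew
    set ζ : F := θ.symm (c *ᵥ v) with hζ_def
    have hcR : c = R ζ := hRsurj c hc
    rw [hcR] at hcskew ⊢
    have hζξ := hcomm_of_skew ζ hcskew
    refine hext fun A ↦ ?_
    rw [← Matrix.mulVec_mulVec, hR, hR, ← Matrix.mulVec_mulVec, hR, hR, mul_assoc, mul_assoc]
    congr 2
    exact Subtype.ext hζξ.symm

end RationalCore

/-! ## §2 The real step: rational descent of `J ∈ C(X) ⊗ ℝ`, `J† = -J` -/

section RealStep

variable {κ : Type} [Fintype κ] [DecidableEq κ] {E : Type*} [NormedAddCommGroup E]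
  [NormedSpace ℂ E] {Ψ : (κ → ℝ) ≃L[ℝ] E} {η : E [⋀^Fin 2]→L[ℝ] ℝ} {G : Matrix κ κ ℚ}

omit [DecidableEq κ] in
/-- Realification is multiplicative. [folklore] -/
private theorem map_ratCast_mul_aux (A B : Matrix κ κ ℚ) :
    (A * B).map (Rat.cast : ℚ → ℝ) = A.map (Rat.cast : ℚ → ℝ) * B.map (Rat.cast : ℚ → ℝ) :=
  Matrix.map_mul (f := Rat.castHom ℝ)

/-- Realification commutes with the Rosati involution of a rational Gram matrix. [folklore] -/
private theorem map_ratCast_rosati_aux (hη : IsRiemannForm Ψ η)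
    (hG : G.map (Rat.cast : ℚ → ℝ) = latticeGram Ψ η) (A : Matrix κ κ ℚ) :
    (rosati G A).map (Rat.cast : ℚ → ℝ) = rosati (latticeGram Ψ η) (A.map (Rat.cast : ℚ → ℝ)) := by
  have hGu : IsUnit G.det := isUnit_det_of_map_ratCast hG hη.isUnit_det_latticeGram
  rw [show (rosati G A).map (Rat.cast : ℚ → ℝ) = (rosati G A).map (Rat.castHom ℝ) from rfl,
    rosati_map (Rat.castHom ℝ) hGu, Rat.coe_castHom, hG]

/-- **Rational descent of the complex structure through the skew part of `C(X)`.** For a polarised complex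
torus `X = E/Ψ(ℤ^κ)` with rational Gram matrix `G` (`† = rosati G`, Milne's `C(X)` = the rational commutant
`Subalgebra.centralizer ℚ End_ℚ(X)`): a rational matrix commuting with every `†`-SKEW element of `C(X)` is an
endomorphism, `a ∈ End_ℚ(X)`.  Indeed `J ∈ C(X) ⊗ ℝ` (`jMatrix_mem_span_centralizer_endAlgRat`, the proof of
Lange Prop. 7.2.6) and `J† = -J` (`rosati_jMatrix`), so `2J = J - J†` is a real combination of the rational skew
elements `γ - γ†`, `γ ∈ C(X)` (`C(X)` is `†`-stable), all of which commute with `a`; and `End_ℚ(X)` is the set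
of rational matrices commuting with `J`. [cite: Lange2023AbelianVarietiesComplex, §7.2.2 Prop. 7.2.5 and §7.2.3 Prop. 7.2.6 (proofs: `End_ℚ(X) = {φ | φJ = Jφ}`, rational descent)]
[cite: Milne1999LefschetzClasses, §1 (p. 643: "`C(A)` is a `k`-algebra stable under the involution `†`")] -/
theorem mem_endAlgRat_of_forall_skew_centralizer_commute (hη : IsRiemannForm Ψ η)
    (hG : G.map (Rat.cast : ℚ → ℝ) = latticeGram Ψ η) {a : Matrix κ κ ℚ}
    (ha : ∀ c ∈ Subalgebra.centralizer ℚ (endAlgRat Ψ : Set (Matrix κ κ ℚ)), rosati G c = -c →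
      c * a = a * c) : a ∈ endAlgRat Ψ := by
  have hGu : IsUnit G.det := isUnit_det_of_map_ratCast hG hη.isUnit_det_latticeGram
  have hGt : Gᵀ = -G := transpose_eq_neg_of_map_ratCast Ψ hG
  -- `(M - M†) a = a (M - M†)` on the real span of the realified `C(X)`
  have key : ∀ M ∈ Submodule.span ℝ ((fun A : Matrix κ κ ℚ ↦ A.map (Rat.cast : ℚ → ℝ)) ''
      (Subalgebra.centralizer ℚ (endAlgRat Ψ : Set (Matrix κ κ ℚ)) : Set (Matrix κ κ ℚ))),
      (M - rosati (latticeGram Ψ η) M) * a.map (Rat.cast : ℚ → ℝ) =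
        a.map (Rat.cast : ℚ → ℝ) * (M - rosati (latticeGram Ψ η) M) := by
    intro M hM
    induction hM using Submodule.span_induction with
    | mem M hM =>
      obtain ⟨γ, hγ, rfl⟩ := hM
      have hγ' : γ - rosati G γ ∈ Subalgebra.centralizer ℚ (endAlgRat Ψ : Set (Matrix κ κ ℚ)) :=
        Subalgebra.sub_mem _ hγ (hη.rosati_mem_centralizer_endAlgRat hG hγ)
      have hskew : rosati G (γ - rosati G γ) = -(γ - rosati G γ) := by
        rw [rosati_sub, rosati_rosati hGu hGt, neg_sub]
      have h := ha _ hγ' hskew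
      rw [← map_ratCast_rosati_aux hη hG, ← Matrix.map_sub (Rat.cast : ℚ → ℝ) Rat.cast_sub,
        ← map_ratCast_mul_aux, ← map_ratCast_mul_aux, h]
    | zero => rw [rosati_zero, sub_zero, zero_mul, mul_zero]
    | add M N _ _ hM hN => rw [rosati_add, add_sub_add_comm, add_mul, mul_add, hM, hN]
    | smul r M _ hM => rw [rosati_smul, ← smul_sub, smul_mul_assoc, mul_smul_comm, hM]
  have hJ := key _ (jMatrix_mem_span_centralizer_endAlgRat Ψ)
  rw [rosati_jMatrix Ψ hη.1 hη.isUnit_det_latticeGram, sub_neg_eq_add, ← two_smul ℝ, smul_mul_assoc,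
    mul_smul_comm] at hJ
  exact (mem_endAlgRat_iff Ψ a).2 (smul_right_injective (Matrix κ κ ℝ) two_ne_zero hJ).symm

end RealStep

/-! ## §3 Shimura's exceptional case (1) at torus level -/

section Torus

open NumberField
open Literature.RingTheory.CentralSimple
open Literature.NumberTheory.Automorphic (IsQuaternionAlgebra standardInvolution reducedTrace
  self_add_standardInvolution)

variable {κ : Type} [Fintype κ] [DecidableEq κ] [Nonempty κ] {E : Type*} [NormedAddCommGroup E]
  [NormedSpace ℂ E] {Ψ : (κ → ℝ) ≃L[ℝ] E} {η : E [⋀^Fin 2]→L[ℝ] ℝ} {G : Matrix κ κ ℚ}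

/-- `ℚ ⊆ K ⊆ End_ℚ(X)` is a scalar tower. [folklore] -/
private theorem isScalarTower_rat₈ (hX : IsSimple Ψ) :
    IsScalarTower ℚ (centerField Ψ hX) (endAlgRat Ψ) :=
  IsScalarTower.of_algebraMap_smul fun q x ↦ by
    rw [Algebra.smul_def, Algebra.algebraMap_eq_smul_one q,
      map_rat_smul (algebraMap (centerField Ψ hX) (endAlgRat Ψ)) q 1, map_one, smul_mul_assoc, one_mul]

/-- **Type III: the Rosati involution is the canonical anti-involution, so `f + f'` is central.** For a
simple polarised complex torus whose pair `(End_ℚ(X), ′)` is of Albert type III, `′` is `x ↦ x̄` on the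
quaternion algebra `F = End_ℚ(X)` over its centre `K` (Thm. 2.6.5 (c): the positive anti-involutions of the
first kind on a totally definite quaternion algebra; tree `isPositiveAntiInvolution_iff_of_isOfFirstKind`),
hence `f + f' = trd(f) ∈ K` commutes with `End_ℚ(X)`. [cite: Lange2023AbelianVarietiesComplex, §2.6.2 Thm. 2.6.5 (c) (PDF p0141) and its proof, Step III (p0142)] -/
theorem IsSimple.add_rosati_mul_comm_of_isAlbertTypeIII (hX : IsSimple Ψ) (hη : IsRiemannForm Ψ η)
    (hG : G.map (Rat.cast : ℚ → ℝ) = latticeGram Ψ η)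
    (h : IsAlbertTypeIII (centerField Ψ hX) (endAlgRat Ψ) (rosatiEnd Ψ hη.1 hη.2.2 hG))
    {A B : Matrix κ κ ℚ} (hA : A ∈ endAlgRat Ψ) (hB : B ∈ endAlgRat Ψ) :
    (A + rosati G A) * B = B * (A + rosati G A) := by
  haveI := isScalarTower_rat₈ hX
  haveI := h.isQuaternionAlgebra
  have hD : ∀ x : endAlgRat Ψ, x ≠ 0 → IsUnit x := fun x hx ↦ hX.isUnit_endAlgRat hx
  obtain ⟨-, hc⟩ := (isPositiveAntiInvolution_iff_of_isOfFirstKind (centerField Ψ hX) hD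
    h.isOfFirstKind).mp (hη.isPositiveAntiInvolution_rosati hG)
  have hstd : ∀ x, rosatiEnd Ψ hη.1 hη.2.2 hG x = standardInvolution (centerField Ψ hX) (endAlgRat Ψ) x := by
    rcases hc with ⟨-, hc⟩ | ⟨hind, -⟩
    · exact hc
    · obtain ⟨w⟩ := (inferInstance : Nonempty (InfinitePlace (centerField Ψ hX)))
      exact absurd (hind.isSplitAtInfinite w) (h.isTotallyDefinite w)
  have h1 : (⟨A, hA⟩ : endAlgRat Ψ) + rosatiEnd Ψ hη.1 hη.2.2 hG ⟨A, hA⟩ =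
      algebraMap (centerField Ψ hX) (endAlgRat Ψ) (reducedTrace (centerField Ψ hX) (endAlgRat Ψ) ⟨A, hA⟩) := by
    rw [hstd]
    exact self_add_standardInvolution (centerField Ψ hX) _
  have h2 := Algebra.commutes (reducedTrace (centerField Ψ hX) (endAlgRat Ψ) ⟨A, hA⟩) (⟨B, hB⟩ : endAlgRat Ψ)
  rw [← h1] at h2
  exact congrArg Subtype.val h2

/-- **Shimura's exceptional case (1), every dimension (Hulek–Laface Prop. 5.1, case (1)): for a SIMPLE
polarised complex torus of Albert type III, `dim_ℚ End_ℚ(X) ≠ rk Λ` — the lattice is not a rank-one module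
over the definite quaternion algebra `F = End_ℚ(X)` ("`F` is of type III, and `m := g/2e = 1` […] under the
assumption that our abelian variety `X` be simple, one can show that these cases never occur").**  Declared
deviation from the printed proofs (Shimura's moduli count; HL: "`X` is isogenous to a square `Y²`"): if
`dim_ℚ F = rk Λ`, the rational core `exists_skew_mem_centralizer_forall_commute` (with `′ = x̄` on `F`,
`IsSimple.add_rosati_mul_comm_of_isAlbertTypeIII`, and the positivity of `′`, Thm. 2.4.9) produces a non-zero
`†`-skew `a ∈ C(X)` commuting with the skew part of `C(X)`; by `mem_endAlgRat_of_forall_skew_centralizer_commute`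
`a ∈ End_ℚ(X) ∩ C(X) = K`, on which `′` is the identity (first kind) — contradicting `a† = -a ≠ 0`.
[cite: HulekLaface2019PicardNumbersAV, §5.1 Prop. 5.1, exceptional case (1) and its proof (arXiv p. 10)]
[cite: Shimura1963AnalyticFamilies, §4 (the exceptional case "type III, `m = 1`"; through Hulek–Laface)]
[cite: Lange2023AbelianVarietiesComplex, §2.6.1 Proposition and table (PDF p0138: type III, `[F:ℚ] = 4e`, `2e ∣ g`)] -/
theorem IsSimple.finrank_endAlgRat_ne_card_of_isAlbertTypeIII (hX : IsSimple Ψ) (hη : IsRiemannForm Ψ η)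
    (hG : G.map (Rat.cast : ℚ → ℝ) = latticeGram Ψ η)
    (h : IsAlbertTypeIII (centerField Ψ hX) (endAlgRat Ψ) (rosatiEnd Ψ hη.1 hη.2.2 hG)) :
    finrank ℚ (endAlgRat Ψ) ≠ Fintype.card κ := by
  intro hdim
  have hGu : IsUnit G.det := isUnit_det_of_map_ratCast hG hη.isUnit_det_latticeGram
  have hGt : Gᵀ = -G := transpose_eq_neg_of_map_ratCast Ψ hG
  obtain ⟨a, haC, ha0, haskew, hcomm⟩ := exists_skew_mem_centralizer_forall_commute (endAlgRat Ψ) hGu hGt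
    (fun A hA ↦ rosati_mem_endAlgRat Ψ hη.1 hη.2.2 hG hA)
    (fun A hA hA0 ↦ hX.isUnit_of_mem_endAlgRat hA hA0)
    (fun A hA hA0 ↦ trace_rosati_mul_self_pos_rat Ψ hη.1 hη.2.2 hG hA hA0)
    (fun A hA B hB ↦ hX.add_rosati_mul_comm_of_isAlbertTypeIII hη hG h hA hB) hdim
  have haE : a ∈ endAlgRat Ψ := mem_endAlgRat_of_forall_skew_centralizer_commute hη hG hcomm
  -- `a ∈ End_ℚ(X) ∩ C(X)` is central, so `a' = a` (first kind); with `a' = -a` this forces `a = 0`.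
  obtain ⟨z, hz⟩ := centerField.exists_val_eq Ψ hX haE fun B hB ↦
    ((Subalgebra.mem_centralizer_iff ℚ).1 haC B hB).symm
  have hfix : rosati G a = a := by
    have h1 := congrArg (fun x : endAlgRat Ψ ↦ (x : Matrix κ κ ℚ)) (h.isOfFirstKind z)
    simp only [coe_rosatiEnd, centerField.coe_algebraMap, hz] at h1
    exact h1
  refine ha0 ((smul_eq_zero.1 (?_ : (2 : ℚ) • a = 0)).resolve_left two_ne_zero)
  rw [two_smul]
  nth_rw 1 [← hfix]
  rw [haskew, neg_add_cancel]

variable [FiniteDimensional ℂ E]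

/-- **`dim_ℚ End_ℚ(X) ≠ 2g` for a simple polarised complex torus of Albert type III** (`rk Λ = 2 dim_ℂ X`):
Shimura's exceptional case (1) «type III, `m = g/2e = 1`» does not occur for simple `X`.
[cite: HulekLaface2019PicardNumbersAV, §5.1 Prop. 5.1, exceptional case (1) and its proof (arXiv p. 10)]
[cite: Shimura1963AnalyticFamilies, §4 (through Hulek–Laface)] -/
theorem IsSimple.finrank_endAlgRat_ne_two_mul_finrank_of_isAlbertTypeIII (hX : IsSimple Ψ)
    (hη : IsRiemannForm Ψ η) (hG : G.map (Rat.cast : ℚ → ℝ) = latticeGram Ψ η)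
    (h : IsAlbertTypeIII (centerField Ψ hX) (endAlgRat Ψ) (rosatiEnd Ψ hη.1 hη.2.2 hG)) :
    finrank ℚ (endAlgRat Ψ) ≠ 2 * finrank ℂ E := by
  rw [← card_eq_two_mul_finrank Ψ]
  exact hX.finrank_endAlgRat_ne_card_of_isAlbertTypeIII hη hG h

/-- **Type III ⟹ `g = 2em` with `m ≥ 2`** (`e = [K : ℚ]`): the table's restriction `2e ∣ g` for type III
(Lange §2.6.1 Proposition; tree `IsSimple.finrank_centerField_mul_finrank_dvd` with `[F : K] = 4`) sharpened
by Shimura's exclusion of `m = 1`. [cite: HulekLaface2019PicardNumbersAV, §5.1 Prop. 5.1, exceptional case (1) (arXiv p. 10)]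
[cite: Lange2023AbelianVarietiesComplex, §2.6.1 Proposition, table line III ("`2e ∣ g`", PDF p0138) and proof (p0139 L1–L3)] -/
theorem IsSimple.exists_finrank_eq_two_mul_mul_of_isAlbertTypeIII (hX : IsSimple Ψ) (hη : IsRiemannForm Ψ η)
    (hG : G.map (Rat.cast : ℚ → ℝ) = latticeGram Ψ η)
    (h : IsAlbertTypeIII (centerField Ψ hX) (endAlgRat Ψ) (rosatiEnd Ψ hη.1 hη.2.2 hG)) :
    ∃ m : ℕ, 2 ≤ m ∧ finrank ℂ E = 2 * finrank ℚ (centerField Ψ hX) * m := by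
  haveI := isScalarTower_rat₈ hX
  have h4 : finrank (centerField Ψ hX) (endAlgRat Ψ) = 4 := h.finrank_eq_four
  have hdvd := hX.finrank_centerField_mul_finrank_dvd (Ψ := Ψ)
  have hne := hX.finrank_endAlgRat_ne_two_mul_finrank_of_isAlbertTypeIII hη hG h
  rw [← Module.finrank_mul_finrank ℚ (centerField Ψ hX) (endAlgRat Ψ), h4] at hne
  rw [h4] at hdvd
  obtain ⟨m, hm⟩ := hdvd
  have he : 0 < finrank ℚ (centerField Ψ hX) := finrank_pos
  have hg : 0 < finrank ℂ E := by
    have hc : 0 < Fintype.card κ := Fintype.card_pos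
    rw [card_eq_two_mul_finrank Ψ] at hc
    omega
  set e := finrank ℚ (centerField Ψ hX) with he_def
  have hgm : finrank ℂ E = 2 * e * m := by
    apply Nat.eq_of_mul_eq_mul_left two_pos
    rw [hm]
    ring
  refine ⟨m, ?_, hgm⟩
  rcases m with _ | _ | m
  · omega
  · exact absurd hm.symm (by simpa using hne)
  · omega

/-- **`4e ≤ g` for a simple polarised complex torus of type III** (equivalently `m = g/2e ≥ 2`).
[cite: HulekLaface2019PicardNumbersAV, §5.1 Prop. 5.1, exceptional case (1) (arXiv p. 10)] -/
theorem IsSimple.four_mul_finrank_centerField_le_of_isAlbertTypeIII (hX : IsSimple Ψ)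
    (hη : IsRiemannForm Ψ η) (hG : G.map (Rat.cast : ℚ → ℝ) = latticeGram Ψ η)
    (h : IsAlbertTypeIII (centerField Ψ hX) (endAlgRat Ψ) (rosatiEnd Ψ hη.1 hη.2.2 hG)) :
    4 * finrank ℚ (centerField Ψ hX) ≤ finrank ℂ E := by
  obtain ⟨m, hm2, hgm⟩ := hX.exists_finrank_eq_two_mul_mul_of_isAlbertTypeIII hη hG h
  rw [hgm, mul_assoc, mul_comm _ m, ← mul_assoc]
  exact Nat.mul_le_mul_right _ (by omega)

/-! ## §4 Low dimension: no type III in prime dimension; `g ≤ 7` forces `K = ℚ` and `g ∈ {4, 6}` -/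

/-- **"A simple `X` of prime dimension cannot be of Type 3"** (Moonen–Zarhin): `g = 2em` with `m ≥ 2` is
never prime (for `g = 2` this is Shimura's exclusion, for odd primes the table's `2e ∣ g`).
[cite: MoonenZarhin1999LowDim, §2, remark after the Theorem on simple abelian varieties of prime dimension (arXiv p. 6: «a simple `X` of prime dimension cannot be of Type 3»)]
[cite: HulekLaface2019PicardNumbersAV, §5.1 Prop. 5.1, exceptional case (1) (arXiv p. 10)] -/
theorem IsSimple.not_isAlbertTypeIII_of_prime (hX : IsSimple Ψ) (hη : IsRiemannForm Ψ η)
    (hG : G.map (Rat.cast : ℚ → ℝ) = latticeGram Ψ η) (hp : (finrank ℂ E).Prime) :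
    ¬ IsAlbertTypeIII (centerField Ψ hX) (endAlgRat Ψ) (rosatiEnd Ψ hη.1 hη.2.2 hG) := by
  intro h
  obtain ⟨m, hm2, hgm⟩ := hX.exists_finrank_eq_two_mul_mul_of_isAlbertTypeIII hη hG h
  have he : 0 < finrank ℚ (centerField Ψ hX) := finrank_pos
  have h2 : 2 ∣ finrank ℂ E := ⟨finrank ℚ (centerField Ψ hX) * m, by rw [hgm]; ring⟩
  rcases hp.eq_one_or_self_of_dvd 2 h2 with h21 | h2g
  · omega
  · have hk : 2 ≤ finrank ℚ (centerField Ψ hX) * m :=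
      le_trans (by omega) (Nat.mul_le_mul he hm2)
    have : finrank ℂ E = 2 * (finrank ℚ (centerField Ψ hX) * m) := by rw [hgm]; ring
    omega

/-- **Type III in dimension `g ≤ 7`: `K = ℚ` and `g ∈ {4, 6}`** ("type 3 does not occur for `g ≤ 3` and
`g = 5` (`X` simple!)", and `7` is prime): from `g = 2em`, `m ≥ 2`, `2em ≤ 7`.
[cite: MoonenZarhin1999LowDim, §2 (arXiv p. 5: «type 3 does not occur for `g ≤ 3` and `g = 5` (`X` simple!)»; p. 6: prime dimension)]
[cite: HulekLaface2019PicardNumbersAV, §5.1 Prop. 5.1, exceptional case (1) (arXiv p. 10)] -/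
theorem IsSimple.finrank_centerField_eq_one_of_isAlbertTypeIII_of_finrank_le_seven (hX : IsSimple Ψ)
    (hη : IsRiemannForm Ψ η) (hG : G.map (Rat.cast : ℚ → ℝ) = latticeGram Ψ η)
    (h : IsAlbertTypeIII (centerField Ψ hX) (endAlgRat Ψ) (rosatiEnd Ψ hη.1 hη.2.2 hG))
    (hg : finrank ℂ E ≤ 7) :
    finrank ℚ (centerField Ψ hX) = 1 ∧ (finrank ℂ E = 4 ∨ finrank ℂ E = 6) := by
  obtain ⟨m, hm2, hgm⟩ := hX.exists_finrank_eq_two_mul_mul_of_isAlbertTypeIII hη hG h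
  have he : 0 < finrank ℚ (centerField Ψ hX) := finrank_pos
  set e := finrank ℚ (centerField Ψ hX) with he_def
  rw [mul_assoc] at hgm
  set k := e * m with hk_def
  have hk3 : k ≤ 3 := by omega
  have he1 : e = 1 := by
    by_contra hne
    have h2e : 2 ≤ e := by omega
    have := Nat.mul_le_mul h2e hm2
    omega
  refine ⟨he1, ?_⟩
  rw [he1, one_mul] at hk_def
  omega

end Torus

/-! ## §5 Hypothesis-light form: `End_ℚ(X)` a totally definite quaternion algebra over its centre -/

section Definite

open NumberField
open Literature.RingTheory.CentralSimple
open Literature.NumberTheory.Automorphic (IsQuaternionAlgebra IsTotallyDefinite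
  isTotallyReal_of_isTotallyDefinite_holds)

variable {κ : Type} [Fintype κ] [DecidableEq κ] [Nonempty κ] {E : Type*} [NormedAddCommGroup E]
  [NormedSpace ℂ E] {Ψ : (κ → ℝ) ≃L[ℝ] E} {η : E [⋀^Fin 2]→L[ℝ] ℝ} {G : Matrix κ κ ℚ}

/-- **A simple polarised torus whose `End_ℚ(X)` is a totally definite quaternion algebra over its centre is of
Albert type III** for every polarisation: the centre of a totally definite quaternion algebra is totally real
(Vignéras V §1 Ex. 1.1 (a), tree `isTotallyReal_of_isTotallyDefinite_holds`), and over a totally real centre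
the Rosati involution is of the first kind (`IsSimple.isOfFirstKind_rosatiEnd_iff_isTotallyReal`, Lemma 2.6.4).
[cite: Lange2023AbelianVarietiesComplex, §2.6.1 table line III (PDF p0138) and §2.6.2 Lemma 2.6.4, Thm. 2.6.5 (c) (p0141)]
[cite: VignerasLNM800, Ch. V §1 Exercice 1.1 (a)] -/
theorem IsSimple.isAlbertTypeIII_of_isTotallyDefinite (hX : IsSimple Ψ) (hη : IsRiemannForm Ψ η)
    (hG : G.map (Rat.cast : ℚ → ℝ) = latticeGram Ψ η)
    [IsQuaternionAlgebra (centerField Ψ hX) (endAlgRat Ψ)]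
    (hdef : IsTotallyDefinite (centerField Ψ hX) (endAlgRat Ψ)) :
    IsAlbertTypeIII (centerField Ψ hX) (endAlgRat Ψ) (rosatiEnd Ψ hη.1 hη.2.2 hG) :=
  haveI : IsTotallyReal (centerField Ψ hX) :=
    isTotallyReal_of_isTotallyDefinite_holds (centerField Ψ hX) (endAlgRat Ψ) hdef
  { isTotallyReal := ‹_›
    isQuaternionAlgebra := ‹_›
    isTotallyDefinite := hdef
    isOfFirstKind := (hX.isOfFirstKind_rosatiEnd_iff_isTotallyReal hη hG).2 ‹_› }

variable [FiniteDimensional ℂ E]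

/-- **Shimura's case (1), polarisation-free statement: if `End_ℚ(X)` of a simple polarised complex torus is a
totally definite quaternion algebra over its centre `K`, then `dim_ℚ End_ℚ(X) ≠ 2 dim X`** (any rational Gram
matrix of the polarisation will do, `IsRiemannForm.exists_ratMatrix_latticeGram`).  Generalises the tree's
`IsSimple.not_isTotallyDefinite_of_finrank_eq_two` (`g = 2`, where `[End_ℚ(X) : ℚ] = 4 = 2g` is automatic).
[cite: HulekLaface2019PicardNumbersAV, §5.1 Prop. 5.1, exceptional case (1) and its proof (arXiv p. 10)]
[cite: Shimura1963AnalyticFamilies, §4 (through Hulek–Laface)] -/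
theorem IsSimple.finrank_endAlgRat_ne_two_mul_finrank_of_isTotallyDefinite (hX : IsSimple Ψ)
    (hη : IsRiemannForm Ψ η) [IsQuaternionAlgebra (centerField Ψ hX) (endAlgRat Ψ)]
    (hdef : IsTotallyDefinite (centerField Ψ hX) (endAlgRat Ψ)) :
    finrank ℚ (endAlgRat Ψ) ≠ 2 * finrank ℂ E := by
  obtain ⟨G, hG⟩ := hη.exists_ratMatrix_latticeGram
  exact hX.finrank_endAlgRat_ne_two_mul_finrank_of_isAlbertTypeIII hη hG
    (hX.isAlbertTypeIII_of_isTotallyDefinite hη hG hdef)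

/-- **`g = 2em`, `m ≥ 2`, for a simple polarised torus with totally definite quaternion multiplication by its
full endomorphism algebra** (`e = [K : ℚ]`). [cite: HulekLaface2019PicardNumbersAV, §5.1 Prop. 5.1, exceptional case (1) (arXiv p. 10)]
[cite: Lange2023AbelianVarietiesComplex, §2.6.1 Proposition, table line III ("`2e ∣ g`", PDF p0138)] -/
theorem IsSimple.exists_finrank_eq_two_mul_mul_of_isTotallyDefinite (hX : IsSimple Ψ)
    (hη : IsRiemannForm Ψ η) [IsQuaternionAlgebra (centerField Ψ hX) (endAlgRat Ψ)]
    (hdef : IsTotallyDefinite (centerField Ψ hX) (endAlgRat Ψ)) :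
    ∃ m : ℕ, 2 ≤ m ∧ finrank ℂ E = 2 * finrank ℚ (centerField Ψ hX) * m := by
  obtain ⟨G, hG⟩ := hη.exists_ratMatrix_latticeGram
  exact hX.exists_finrank_eq_two_mul_mul_of_isAlbertTypeIII hη hG
    (hX.isAlbertTypeIII_of_isTotallyDefinite hη hG hdef)

/-- **`4e ≤ g`** in the same situation. [cite: HulekLaface2019PicardNumbersAV, §5.1 Prop. 5.1, exceptional case (1) (arXiv p. 10)] -/
theorem IsSimple.four_mul_finrank_centerField_le_of_isTotallyDefinite (hX : IsSimple Ψ)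
    (hη : IsRiemannForm Ψ η) [IsQuaternionAlgebra (centerField Ψ hX) (endAlgRat Ψ)]
    (hdef : IsTotallyDefinite (centerField Ψ hX) (endAlgRat Ψ)) :
    4 * finrank ℚ (centerField Ψ hX) ≤ finrank ℂ E := by
  obtain ⟨G, hG⟩ := hη.exists_ratMatrix_latticeGram
  exact hX.four_mul_finrank_centerField_le_of_isAlbertTypeIII hη hG
    (hX.isAlbertTypeIII_of_isTotallyDefinite hη hG hdef)

/-- **No totally definite quaternion `End_ℚ(X)` in prime dimension** (Moonen–Zarhin).
[cite: MoonenZarhin1999LowDim, §2 (arXiv p. 6: «a simple `X` of prime dimension cannot be of Type 3»)]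
[cite: HulekLaface2019PicardNumbersAV, §5.1 Prop. 5.1, exceptional case (1) (arXiv p. 10)] -/
theorem IsSimple.not_isTotallyDefinite_of_prime (hX : IsSimple Ψ) (hη : IsRiemannForm Ψ η)
    (hp : (finrank ℂ E).Prime) [IsQuaternionAlgebra (centerField Ψ hX) (endAlgRat Ψ)] :
    ¬ IsTotallyDefinite (centerField Ψ hX) (endAlgRat Ψ) := by
  intro hdef
  obtain ⟨G, hG⟩ := hη.exists_ratMatrix_latticeGram
  exact hX.not_isAlbertTypeIII_of_prime hη hG hp (hX.isAlbertTypeIII_of_isTotallyDefinite hη hG hdef)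

end Definite

/-! ## §6 The `g = 4` list sharpened: a totally definite quaternion `End_ℚ(X)` has centre `ℚ` -/

section DimFour

open NumberField
open Literature.RingTheory.CentralSimple
open Literature.NumberTheory.Automorphic (IsQuaternionAlgebra IsTotallyDefinite)

variable {κ : Type} [Fintype κ] [DecidableEq κ] [Nonempty κ] {E : Type*} [NormedAddCommGroup E]
  [NormedSpace ℂ E] [FiniteDimensional ℂ E] {Ψ : (κ → ℝ) ≃L[ℝ] E} {η : E [⋀^Fin 2]→L[ℝ] ℝ}

/-- **`End_ℚ(X)` of a simple polarised complex torus of dimension `4`, with Shimura's case (1)** (Lange's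
table at `g = 4`, tree `IsSimple.endAlgRat_cases_of_finrank_eq_four`, sharpened in the quaternion case):
(I) `F = K` totally real, `[K : ℚ] ∈ {1, 2, 4}`; (II) `F` a totally INDEFINITE quaternion algebra over a
totally real `K`, `[K : ℚ] ∈ {1, 2}`; (III) `F` a totally DEFINITE quaternion algebra over `K = ℚ` (`e = 2`,
i.e. `m = g/2e = 1`, is Shimura's excluded case); (IV) `F = K` a CM field, `[K : ℚ] ∈ {2, 4, 8}`, or `F` a
quaternion algebra over an imaginary quadratic `K`.
[cite: HulekLaface2019PicardNumbersAV, §5.1 Prop. 5.1, exceptional case (1) (arXiv p. 10)]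
[cite: Lange2023AbelianVarietiesComplex, §2.6.1 Proposition, table with the «restriction» column at `g = 4` (PDF p0138)] -/
theorem IsSimple.endAlgRat_cases_of_finrank_eq_four' (hX : IsSimple Ψ) (hη : IsRiemannForm Ψ η)
    (hg : finrank ℂ E = 4) :
    (IsTotallyReal (centerField Ψ hX) ∧ finrank (centerField Ψ hX) (endAlgRat Ψ) = 1 ∧
        (finrank ℚ (centerField Ψ hX) = 1 ∨ finrank ℚ (centerField Ψ hX) = 2 ∨
          finrank ℚ (centerField Ψ hX) = 4)) ∨
      (IsTotallyReal (centerField Ψ hX) ∧ IsQuaternionAlgebra (centerField Ψ hX) (endAlgRat Ψ) ∧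
        IsTotallyIndefinite (centerField Ψ hX) (endAlgRat Ψ) ∧
        (finrank ℚ (centerField Ψ hX) = 1 ∨ finrank ℚ (centerField Ψ hX) = 2)) ∨
      (IsTotallyReal (centerField Ψ hX) ∧ IsQuaternionAlgebra (centerField Ψ hX) (endAlgRat Ψ) ∧
        IsTotallyDefinite (centerField Ψ hX) (endAlgRat Ψ) ∧ finrank ℚ (centerField Ψ hX) = 1) ∨
      (IsCMField (centerField Ψ hX) ∧ finrank (centerField Ψ hX) (endAlgRat Ψ) = 1 ∧
        (finrank ℚ (centerField Ψ hX) = 2 ∨ finrank ℚ (centerField Ψ hX) = 4 ∨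
          finrank ℚ (centerField Ψ hX) = 8)) ∨
      (IsCMField (centerField Ψ hX) ∧ IsQuaternionAlgebra (centerField Ψ hX) (endAlgRat Ψ) ∧
        finrank ℚ (centerField Ψ hX) = 2) := by
  rcases hX.endAlgRat_cases_of_finrank_eq_four hη hg with h1 | ⟨hK, hQ, hdi, he⟩ | h3 | h4
  · exact Or.inl h1
  · rcases hdi with hdef | hind
    · haveI := hQ
      have h4e := hX.four_mul_finrank_centerField_le_of_isTotallyDefinite hη hdef
      exact Or.inr (Or.inr (Or.inl ⟨hK, hQ, hdef, by omega⟩))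
    · exact Or.inr (Or.inl ⟨hK, hQ, hind, he⟩)
  · exact Or.inr (Or.inr (Or.inr (Or.inl h3)))
  · exact Or.inr (Or.inr (Or.inr (Or.inr h4)))

/-- **At `g = 4`, a totally definite quaternion `End_ℚ(X)` is a quaternion algebra over `ℚ`** (`e = 1`,
`m = 2`). [cite: HulekLaface2019PicardNumbersAV, §5.1 Prop. 5.1, exceptional case (1) (arXiv p. 10)] -/
theorem IsSimple.finrank_centerField_eq_one_of_isTotallyDefinite_of_finrank_eq_four (hX : IsSimple Ψ)
    (hη : IsRiemannForm Ψ η) (hg : finrank ℂ E = 4) [IsQuaternionAlgebra (centerField Ψ hX) (endAlgRat Ψ)]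
    (hdef : IsTotallyDefinite (centerField Ψ hX) (endAlgRat Ψ)) : finrank ℚ (centerField Ψ hX) = 1 := by
  have h4e := hX.four_mul_finrank_centerField_le_of_isTotallyDefinite hη hdef
  have he : 0 < finrank ℚ (centerField Ψ hX) := finrank_pos
  omega

end DimFour

end ComplexTorus

end Literature.Geometry.Kaehler
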